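import Mathlib
import Literature.Computability.AlgebraicComplexity.GroupTheoreticMatMul
import Literature.Barriers.MatrixMultiplication.TricoloredSumFreeBarrier

/-!
# Sieve rules for STPP families in finite abelian groups, I: U9′, U13, U14 and tightness ⇒ periodicity

Support file for route `MatrixMultiplication/GroupTheoreticSTPP`, negative crux
`stmt-MatrixMultiplication-0596` (`CAbelianObstructionNeg`), finite-range evidence; cell mm-stpp, rung F-M1:
the kernel form of the packing rules of HOME/CENSUS-PLAN.md §3 used by the census sieve (`SieveAdmissible`,
`Theorems/AbelianSTPPSieve.lean`), ported from the planner's elaboration sketch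
HOME/mm-stpp-plan/PackingSketch.lean (planner gen 2, 2026-08-25; same statements and proofs, tree
namespace; `isSTPP_rotate` = tree `IsSTPP.rotate`).

Census convention `IsSTPP` (word `(s' − s) + (t' − t) + (u' − u)`; quotient sets `A i − B i`,
`B j − C j`, `C k − A k`).  For an STPP family in a finite abelian group `H` and indices `t₀ ≠ j`:

* (U9′)  `|A t₀| · |B t₀| + |A j| · |B j| · |C j| ≤ |H|`  (pattern `(t₀, j, j)`), `card_mul_add_volume_le`;
* (U13)  if `V j + |C j| > |H|` then `A t₀ = ∅ ∨ B t₀ = ∅` (the pattern-`(t₀,j,j)` sumset covers `H`),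
  `isolated_of_volume_add_card_gt`; in particular a full-volume triple is ISOLATED;
* (U14)  `V l + Σ_{t ≠ l} |A t||B t| ≤ |H|` (`volume_add_sum_card_mul_le`);
* (U14-T) tightness of U14 at `l` ⇒ `A l − B l + C l` is invariant under `C l − C l`
  (`translate_eq_of_tight`, `sgnSum_image_add_sub_eq_of_tight`).
Key injectivity: `sgnSum (s, t, u) = s − t + u` is injective on `A j × B j × C j` (the TPP of triple `j`),
so the translate `(A j − B j + C j) − u₀` has `V j` elements, and `A t₀ − B t₀` avoids it.

WHAT THIS IS NOT: no `ω` statement; necessary conditions (packing inequalities) only.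
-/

-- single-conjunct summit: the mandated namespace repeats `MatrixMultiplication`.
set_option linter.dupNamespace false

namespace Summit.MatrixMultiplication.MatrixMultiplication.Theorems

namespace STPPSieveRules

open Finset Literature.Computability.AlgebraicComplexity

variable {H : Type*} [AddCommGroup H] [DecidableEq H] {N : ℕ} {A B C : Fin N → Finset H}


/-- The signed sum `s − t + u` on `A j × B j × C j`. -/
def sgnSum (p : H × H × H) : H := p.1 - p.2.1 + p.2.2

omit [DecidableEq H] in
/-- TPP of triple `j` (inside `IsSTPP`): `(s,t,u) ↦ s − t + u` is injective on `A j ×ˢ B j ×ˢ C j`. -/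
theorem sgnSum_injOn (h : IsSTPP A B C) (j : Fin N) :
    Set.InjOn (sgnSum (H := H)) ↑((A j) ×ˢ (B j) ×ˢ (C j)) := by
  rintro ⟨s₁, t₁, u₁⟩ h₁ ⟨s₂, t₂, u₂⟩ h₂ he
  simp only [coe_product, Set.mem_prod, mem_coe] at h₁ h₂
  simp only [sgnSum] at he
  have key : (s₁ - s₂) + (t₂ - t₁) + (u₁ - u₂) = 0 := by
    have : s₁ - t₁ + u₁ - (s₂ - t₂ + u₂) = 0 := by rw [he]; abel
    rw [← this]; abel
  obtain ⟨-, -, hs, ht, hu⟩ := h j j j s₂ h₂.1 s₁ h₁.1 t₁ h₁.2.1 t₂ h₂.2.1 u₂ h₂.2.2 u₁ h₁.2.2 key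
  simp [hs, ht, hu]

/-- The volume as the size of the signed-sum image. -/
theorem card_image_sgnSum (h : IsSTPP A B C) (j : Fin N) :
    (((A j) ×ˢ (B j) ×ˢ (C j)).image sgnSum).card = (A j).card * (B j).card * (C j).card := by
  rw [card_image_of_injOn (sgnSum_injOn h j), card_product, card_product, mul_assoc]

/-- `|A t₀ − B t₀| = |A t₀| |B t₀|` (needs one element of `C t₀` to instantiate the TPP of `t₀`). -/
theorem card_image_sub (h : IsSTPP A B C) (t₀ : Fin N) (hC : (C t₀).Nonempty) :
    (((A t₀) ×ˢ (B t₀)).image (fun p : H × H => p.1 - p.2)).card = (A t₀).card * (B t₀).card := by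
  obtain ⟨u₀, hu₀⟩ := hC
  rw [card_image_of_injOn, card_product]
  rintro ⟨s₁, t₁⟩ h₁ ⟨s₂, t₂⟩ h₂ he
  simp only [coe_product, Set.mem_prod, mem_coe] at h₁ h₂
  simp only at he
  have key : (s₁ - s₂) + (t₂ - t₁) + (u₀ - u₀) = 0 := by
    have : s₁ - t₁ - (s₂ - t₂) = 0 := by rw [he]; abel
    rw [← this]; abel
  obtain ⟨-, -, hs, ht, -⟩ := h t₀ t₀ t₀ s₂ h₂.1 s₁ h₁.1 t₁ h₁.2 t₂ h₂.2 u₀ hu₀ u₀ hu₀ key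
  simp [hs, ht]

/-- Pattern `(t₀, j, j)`, `j ≠ t₀`: `A t₀ − B t₀` is disjoint from the translate `(A j − B j + C j) − u₀`
(`u₀ ∈ C j`) of the signed-sum image, which lies inside `W j j = (C j − B j) + (A j − C j)`. -/
theorem disjoint_sub_translate (h : IsSTPP A B C) {t₀ j : Fin N} (hj : j ≠ t₀) {u₀ : H} (hu₀ : u₀ ∈ C j) :
    Disjoint (((A t₀) ×ˢ (B t₀)).image (fun p : H × H => p.1 - p.2))
      ((((A j) ×ˢ (B j) ×ˢ (C j)).image sgnSum).image (fun x => x - u₀)) := by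
  rw [disjoint_left]
  intro x hx hx'
  simp only [mem_image, mem_product, Prod.exists, sgnSum] at hx hx'
  obtain ⟨s', t, ⟨hs', ht⟩, rfl⟩ := hx
  obtain ⟨y, ⟨s, t', u, ⟨hs, ht', hu⟩, rfl⟩, he⟩ := hx'
  -- he : s - t' + u - u₀ = s' - t  ⇒  (s' - s) + (t' - t) + (u₀ - u) = 0 with indices (t₀, j, j)
  have key : (s' - s) + (t' - t) + (u₀ - u) = 0 := by
    have : s' - t - (s - t' + u - u₀) = 0 := by rw [← he]; abel
    rw [← this]; abel
  obtain ⟨hij, -, -⟩ := h t₀ j j s hs s' hs' t ht t' ht' u hu u₀ hu₀ key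
  exact hj hij.symm

/-- **U9′ (pairwise volume packing).** For `t₀ ≠ j` in an STPP family (finite abelian `H`, `C t₀ ≠ ∅`):
`|A t₀| |B t₀| + |A j| |B j| |C j| ≤ |H|`. -/
theorem card_mul_add_volume_le (h : IsSTPP A B C) [Fintype H] {t₀ j : Fin N} (hj : j ≠ t₀)
    (hC₀ : (C t₀).Nonempty) (hCj : (C j).Nonempty) :
    (A t₀).card * (B t₀).card + (A j).card * (B j).card * (C j).card ≤ Fintype.card H := by
  obtain ⟨u₀, hu₀⟩ := hCj
  have hd := disjoint_sub_translate h hj hu₀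
  have hcard := card_le_univ ((((A t₀) ×ˢ (B t₀)).image (fun p : H × H => p.1 - p.2)) ∪
      ((((A j) ×ˢ (B j) ×ˢ (C j)).image sgnSum).image (fun x => x - u₀)))
  rw [card_union_of_disjoint hd, card_image_sub h t₀ hC₀,
    card_image_of_injective _ (sub_left_injective), card_image_sgnSum h j] at hcard
  simpa using hcard

/-- **U13 (near-tiling isolation).** If `V j + |C j| > |H|` then every other triple has `A t₀ = ∅` or
`B t₀ = ∅`: the sets `(A j − B j + C j) − u₀`, `u₀ ∈ C j`, cover `H` (an uncovered `x` would give
`x + C j ⊆ H ∖ (A j − B j + C j)`, i.e. `|C j| ≤ |H| − V j`), and `A t₀ − B t₀` avoids all of them. -/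
theorem isolated_of_volume_add_card_gt (h : IsSTPP A B C) [Fintype H] {t₀ j : Fin N} (hj : j ≠ t₀)
    (hbig : Fintype.card H < (A j).card * (B j).card * (C j).card + (C j).card) :
    A t₀ = ∅ ∨ B t₀ = ∅ := by
  by_contra hne
  simp only [not_or, ← ne_eq, ← nonempty_iff_ne_empty] at hne
  obtain ⟨⟨s', hs'⟩, ⟨t, ht⟩⟩ := hne
  set x : H := s' - t with hx
  set S : Finset H := ((A j) ×ˢ (B j) ×ˢ (C j)).image sgnSum with hS
  -- claim: x + C j ⊆ H \ S
  have hsub : ((C j).image (fun u₀ => x + u₀)) ⊆ univ \ S := by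
    intro y hy
    simp only [mem_image] at hy
    obtain ⟨u₀, hu₀, rfl⟩ := hy
    rw [mem_sdiff]
    refine ⟨mem_univ _, ?_⟩
    intro hmem
    have hd := disjoint_sub_translate h hj hu₀
    rw [disjoint_left] at hd
    apply hd (a := x)
    · simp only [mem_image, mem_product, Prod.exists]
      exact ⟨s', t, ⟨hs', ht⟩, rfl⟩
    · exact mem_image.mpr ⟨x + u₀, hS ▸ hmem, by abel⟩
  have h1 : ((C j).image (fun u₀ => x + u₀)).card = (C j).card :=
    card_image_of_injective _ (add_right_injective x)
  have h2 : (univ \ S).card = Fintype.card H - S.card := card_univ_sdiff S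
  have h3 := card_le_card hsub
  rw [h1, h2, hS, card_image_sgnSum h j] at h3
  have h4 : (A j).card * (B j).card * (C j).card ≤ Fintype.card H := by
    have := card_le_univ (((A j) ×ˢ (B j) ×ˢ (C j)).image (sgnSum (H := H)))
    rwa [card_image_sgnSum h j] at this
  omega

/-- `A s − B s` lies inside every translate `(A s − B s + C s) − u₀`, `u₀ ∈ C s`. -/
theorem sub_subset_translate (s : Fin N) {u₀ : H} (hu₀ : u₀ ∈ C s) :
    ((A s) ×ˢ (B s)).image (fun p : H × H => p.1 - p.2) ⊆
      ((((A s) ×ˢ (B s) ×ˢ (C s)).image sgnSum).image (fun x => x - u₀)) := by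
  intro x hx
  simp only [mem_image, mem_product, Prod.exists, sgnSum] at hx ⊢
  obtain ⟨a, b, ⟨ha, hb⟩, rfl⟩ := hx
  exact ⟨a - b + u₀, ⟨a, b, u₀, ⟨ha, hb, hu₀⟩, rfl⟩, by abel⟩

/-- Patterns `(t, s, s)`, `t ≠ s`: the difference sets `A t − B t` and `A s − B s` are disjoint. -/
theorem disjoint_sub_sub (h : IsSTPP A B C) {t s : Fin N} (hts : t ≠ s) (hCs : (C s).Nonempty) :
    Disjoint (((A t) ×ˢ (B t)).image (fun p : H × H => p.1 - p.2))
      (((A s) ×ˢ (B s)).image (fun p : H × H => p.1 - p.2)) := by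
  obtain ⟨u₀, hu₀⟩ := hCs
  exact (disjoint_sub_translate h hts.symm hu₀).mono_right (sub_subset_translate s hu₀)

/-- **U14 (one volume + all other pair-products).** For every index `l` of an STPP family of triples with
non-empty `C`-members in a finite abelian group:
`|A l| |B l| |C l| + Σ_{t ≠ l} |A t| |B t| ≤ |H|` — the sets `A t − B t` (`t ≠ l`) are pairwise disjoint
(patterns `(t,s,s)`) and all avoid the `V l`-element translate `(A l − B l + C l) − u₀ ⊆ W l l`
(pattern `(t,l,l)`).  Subsumes U9′ (one `t`) and U2 (`V l ≥ |A l||B l|`); rotations analogous. -/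
theorem volume_add_sum_card_mul_le (h : IsSTPP A B C) [Fintype H] (l : Fin N)
    (hC : ∀ t, (C t).Nonempty) :
    (A l).card * (B l).card * (C l).card + ∑ t ∈ univ.erase l, (A t).card * (B t).card
      ≤ Fintype.card H := by
  classical
  obtain ⟨u₀, hu₀⟩ := hC l
  set D : Fin N → Finset H := fun t => ((A t) ×ˢ (B t)).image (fun p : H × H => p.1 - p.2) with hD
  set T : Finset H := ((((A l) ×ˢ (B l) ×ˢ (C l)).image sgnSum).image (fun x => x - u₀)) with hT
  have hdisjT : Disjoint ((univ.erase l).biUnion D) T := by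
    rw [disjoint_biUnion_left]
    intro t ht
    exact disjoint_sub_translate h (ne_of_mem_erase ht).symm hu₀
  have hpair : (↑(univ.erase l) : Set (Fin N)).PairwiseDisjoint D := by
    intro t _ s _ hts
    exact disjoint_sub_sub h hts (hC s)
  have hU := card_le_univ ((univ.erase l).biUnion D ∪ T)
  rw [card_union_of_disjoint hdisjT, card_biUnion hpair, hT,
    card_image_of_injective _ (sub_left_injective), card_image_sgnSum h l] at hU
  have hsum : ∑ t ∈ univ.erase l, (D t).card = ∑ t ∈ univ.erase l, (A t).card * (B t).card :=
    sum_congr rfl (fun t _ => card_image_sub h t (hC t))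
  rw [hsum] at hU
  simpa [add_comm] using hU

/-- **U14-T (tightness ⇒ periodicity), ab-rotation.** If U14 is TIGHT at `l`, then all translates
`(A l − B l + C l) − u`, `u ∈ C l`, coincide (each is contained in the complement of `⊔_{t ≠ l} (A t − B t)`
and has the complement's cardinality). -/
theorem translate_eq_of_tight (h : IsSTPP A B C) [Fintype H] (l : Fin N)
    (hC : ∀ t, (C t).Nonempty)
    (htight : (A l).card * (B l).card * (C l).card + ∑ t ∈ univ.erase l, (A t).card * (B t).card
      = Fintype.card H)
    {u₀ u₁ : H} (hu₀ : u₀ ∈ C l) (hu₁ : u₁ ∈ C l) :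
    ((((A l) ×ˢ (B l) ×ˢ (C l)).image sgnSum).image (fun x => x - u₀)) =
      ((((A l) ×ˢ (B l) ×ˢ (C l)).image sgnSum).image (fun x => x - u₁)) := by
  classical
  set S : Finset H := ((A l) ×ˢ (B l) ×ˢ (C l)).image sgnSum with hS
  set D : Fin N → Finset H := fun t => ((A t) ×ˢ (B t)).image (fun p : H × H => p.1 - p.2) with hD
  set R : Finset H := univ \ (univ.erase l).biUnion D with hR
  have hsub : ∀ {u : H}, u ∈ C l → S.image (fun x => x - u) ⊆ R := by
    intro u hu x hx
    rw [hR, mem_sdiff]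
    refine ⟨mem_univ _, ?_⟩
    intro hx'
    rw [mem_biUnion] at hx'
    obtain ⟨t, ht, hxt⟩ := hx'
    have hd := disjoint_sub_translate h (ne_of_mem_erase ht).symm hu
    exact disjoint_left.mp hd hxt hx
  have hcardT : ∀ {u : H}, u ∈ C l →
      (S.image (fun x => x - u)).card = (A l).card * (B l).card * (C l).card := by
    intro u _
    rw [card_image_of_injective _ (sub_left_injective), hS, card_image_sgnSum h l]
  have hpair : (↑(univ.erase l) : Set (Fin N)).PairwiseDisjoint D := by
    intro t _ s _ hts
    exact disjoint_sub_sub h hts (hC s)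
  have hcardR : R.card = (A l).card * (B l).card * (C l).card := by
    have h1 : R.card = Fintype.card H - ((univ.erase l).biUnion D).card := by
      rw [hR, card_univ_sdiff]
    rw [card_biUnion hpair] at h1
    have hsum : ∑ t ∈ univ.erase l, (D t).card = ∑ t ∈ univ.erase l, (A t).card * (B t).card :=
      sum_congr rfl (fun t _ => card_image_sub h t (hC t))
    rw [hsum] at h1
    omega
  have heq : ∀ {u : H}, u ∈ C l → S.image (fun x => x - u) = R := fun hu =>
    eq_of_subset_of_card_le (hsub hu) (by rw [hcardR, hcardT hu])
  rw [heq hu₀, heq hu₁]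

/-- Corollary: under tightness at `l`, `S l = A l − B l + C l` is invariant under every difference
`u₀ − u₁` of elements of `C l` (so `S l` is a union of cosets of the subgroup generated by `C l − C l`,
whose order then divides `|S l| = V l` and `|H|` and is at least `|C l|`). -/
theorem sgnSum_image_add_sub_eq_of_tight (h : IsSTPP A B C) [Fintype H] (l : Fin N)
    (hC : ∀ t, (C t).Nonempty)
    (htight : (A l).card * (B l).card * (C l).card + ∑ t ∈ univ.erase l, (A t).card * (B t).card
      = Fintype.card H)
    {u₀ u₁ : H} (hu₀ : u₀ ∈ C l) (hu₁ : u₁ ∈ C l) :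
    (((A l) ×ˢ (B l) ×ˢ (C l)).image sgnSum).image (fun x => x + (u₀ - u₁)) =
      ((A l) ×ˢ (B l) ×ˢ (C l)).image sgnSum := by
  classical
  have key := congrArg (fun T : Finset H => T.image (fun x => x + u₀))
    (translate_eq_of_tight h l hC htight hu₁ hu₀)
  simp only [image_image, Function.comp_def, sub_add_cancel] at key
  -- key : P.image (fun p => sgnSum p - u₁ + u₀) = P.image (fun p => sgnSum p)
  rw [image_image]
  have hfun : ((fun x : H => x + (u₀ - u₁)) ∘ sgnSum) =
      (fun p : H × H × H => sgnSum p - u₁ + u₀) := by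
    funext p
    simp only [Function.comp]
    abel
  rw [hfun]
  exact key

end STPPSieveRules

end Summit.MatrixMultiplication.MatrixMultiplication.Theorems
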